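import Mathlib
import Literature.NumberTheory.LFunctions.Zhang2022.SkeletonPropositions
import HarnessLib

/-!
# Zhang (2022), §15 (15.15)/(15.17): the error `C·(e^{−c𝓛^{1/10}} + 𝓛^{−1995})` of the ranged
# (15.15) is `o(𝓛^{−60})` — the decay side-condition of the (15.17) assembly edge

Topic `Literature/NumberTheory/LFunctions/Zhang2022` (Landau–Siegel audit tree; verdict-neutral).
Y. Zhang, *Discrete mean estimates and the Landau–Siegel zero*, arXiv:2211.02515v1 (2022)
[Zhang2022LandauSiegel] — **an unrefereed manuscript under adjudication; nothing here asserts or denies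
its Theorems 1–2.** The assembly edge `Typed.Section15B.eq15_17_chi_of` (`Section15BEq1517Assembly`,
the step "Inserting this into (15.11) … + o(p)", §15 p. 85) takes the termwise error `E(D)` of the
ranged (15.15) abstractly, with the side condition `∀ δ > 0, ForAllLarge, 0 ≤ E D ∧ E D·𝓛⁶⁰ ≤ δ`.
The error of record is `E(D) = C·(e^{−c𝓛^{1/10}} + 𝓛^{−1995})` (the printed `ε₁ = e^{−c𝓛^{1/10}}` plus
the residue at `ρ̃ − 1`, polynomially small under (A)). This file PROVES the side condition for it:

* `pow_mul_exp_neg_rpow_tenth_le` — exponentials beat powers: for `ℓ ≥ 1`, `c > 0`,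
  `ℓ^m·exp(−cℓ^{1/10}) ≤ (10m+10)!·c^{−(10m+10)}·ℓ⁻¹` (from `xⁿ/n! ≤ eˣ` at `x = cℓ^{1/10}`);
* `eq15_15_error_decay` — for `C ≥ 0`, `c > 0`, every `m ≤ 1994`: `∀ δ > 0`, for all large `D`,
  `0 ≤ C(e^{−c𝓛^{1/10}} + 𝓛^{−1995})` and `C(e^{−c𝓛^{1/10}} + 𝓛^{−1995})·𝓛^m ≤ δ` (as a `ForAllLarge`).

Theorems only; no definitions, no facts; nothing about Landau–Siegel zeros.

## References

* Y. Zhang, arXiv:2211.02515v1 (2022), §15 (15.15)–(15.17) p. 85. [cite: Zhang2022LandauSiegel, §15 (15.17) p.85]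
-/

noncomputable section

open Real

namespace Literature.NumberTheory.LFunctions.Zhang2022.Typed.Section15B

open Literature.NumberTheory.LFunctions.Zhang2022
open Literature.NumberTheory.LFunctions.Zhang2022.Skeleton

/-- For every `L₀` there is `D₀` with `𝓛 = log D ≥ L₀` for `D ≥ D₀`. [folklore] -/
private theorem exists_nat_ell_ge (L₀ : ℝ) :
    ∃ D₀ : ℕ, ∀ D : ℕ, D₀ ≤ D → L₀ ≤ ell D := by
  refine ⟨⌈Real.exp L₀⌉₊ + 1, fun D hD => ?_⟩
  have h1 : Real.exp L₀ ≤ D := by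
    have : (⌈Real.exp L₀⌉₊ : ℝ) + 1 ≤ D := by exact_mod_cast hD
    linarith [Nat.le_ceil (Real.exp L₀)]
  have hD0 : (0 : ℝ) < D := lt_of_lt_of_le (Real.exp_pos L₀) h1
  unfold ell
  rw [Real.le_log_iff_exp_le hD0]
  exact h1

/-- **Exponentials beat powers**: for `ℓ ≥ 1`, `c > 0` and `m : ℕ`,
`ℓ^m · exp(−cℓ^{1/10}) ≤ (10m+10)! / c^{10m+10} · ℓ⁻¹` (from `x^n/n! ≤ eˣ` at `x = cℓ^{1/10}`,
`n = 10m + 10`, `(ℓ^{1/10})^{10m+10} = ℓ^{m+1}`) — the mechanism behind "`O(ε₁)`, `ε₁ = exp(−c𝓛^{1/10})`,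
is negligible against any power of `𝓛`" in §15. [cite: Zhang2022LandauSiegel, §15 (15.15) p.85] -/
theorem pow_mul_exp_neg_rpow_tenth_le {ℓ c : ℝ} (hℓ : 1 ≤ ℓ) (hc : 0 < c) (m : ℕ) :
    ℓ ^ m * Real.exp (-c * ℓ ^ (1 / 10 : ℝ)) ≤
      (Nat.factorial (10 * m + 10) : ℝ) / c ^ (10 * m + 10) * ℓ⁻¹ := by
  have hℓ0 : 0 < ℓ := by linarith
  set x : ℝ := c * ℓ ^ (1 / 10 : ℝ) with hx
  have hx0 : 0 ≤ x := by rw [hx]; positivity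
  set n : ℕ := 10 * m + 10 with hn
  have hfac : (0 : ℝ) < Nat.factorial n := by exact_mod_cast Nat.factorial_pos n
  have hcn : (0 : ℝ) < c ^ n := pow_pos hc n
  -- `(ℓ^{1/10})^n = ℓ^{m+1}`
  have hpow : (ℓ ^ (1 / 10 : ℝ)) ^ n = ℓ ^ (m + 1) := by
    rw [← Real.rpow_natCast, ← Real.rpow_mul hℓ0.le, hn]
    rw [show (1 / 10 : ℝ) * ((10 * m + 10 : ℕ) : ℝ) = ((m + 1 : ℕ) : ℝ) by push_cast; ring,
      Real.rpow_natCast]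
  have hxn : x ^ n = c ^ n * ℓ ^ (m + 1) := by rw [hx, mul_pow, hpow]
  -- `x^n/n! ≤ e^x`, i.e. `c^n ℓ^{m+1} ≤ n! e^x`
  have hkey : x ^ n / Nat.factorial n ≤ Real.exp x := Real.pow_div_factorial_le_exp x hx0 n
  have hkey' : c ^ n * ℓ ^ (m + 1) ≤ Nat.factorial n * Real.exp x := by
    rw [← hxn]; rwa [div_le_iff₀ hfac, mul_comm] at hkey
  -- rearrange
  have hexp : Real.exp (-c * ℓ ^ (1 / 10 : ℝ)) = (Real.exp x)⁻¹ := by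
    rw [← Real.exp_neg, hx]; ring_nf
  rw [hexp]
  have hex0 : 0 < Real.exp x := Real.exp_pos x
  rw [mul_inv_le_iff₀ hex0]
  have hℓne : ℓ ≠ 0 := hℓ0.ne'
  have hcne : c ^ n ≠ 0 := hcn.ne'
  calc ℓ ^ m = (c ^ n * ℓ ^ (m + 1)) * (c ^ n)⁻¹ * ℓ⁻¹ := by
        field_simp; ring
    _ ≤ (Nat.factorial n * Real.exp x) * (c ^ n)⁻¹ * ℓ⁻¹ := by
        gcongr
    _ = (Nat.factorial n : ℝ) / c ^ n * ℓ⁻¹ * Real.exp x := by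
        rw [div_eq_mul_inv]; ring

/-- **The error of the ranged (15.15) is `o(𝓛^{−m})` for every `m ≤ 1994`**: for `C ≥ 0`, `c > 0`,
`E(D) = C·(e^{−c𝓛^{1/10}} + (𝓛^{1995})⁻¹)` satisfies `∀ δ > 0, ForAllLarge (0 ≤ E D ∧ E D·𝓛^m ≤ δ)` —
the side condition of `eq15_17_chi_of` (there `m = 60`). [cite: Zhang2022LandauSiegel, §15 (15.17) p.85] -/
theorem eq15_15_error_decay {C c : ℝ} (hC : 0 ≤ C) (hc : 0 < c) {m : ℕ} (hm : m ≤ 1994) :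
    ∀ δ : ℝ, 0 < δ → ForAllLarge fun D _ _ =>
      0 ≤ C * (Real.exp (-c * ell D ^ (1 / 10 : ℝ)) + (ell D ^ 1995)⁻¹) ∧
        C * (Real.exp (-c * ell D ^ (1 / 10 : ℝ)) + (ell D ^ 1995)⁻¹) * ell D ^ m ≤ δ := by
  intro δ hδ
  set F : ℝ := (Nat.factorial (10 * m + 10) : ℝ) / c ^ (10 * m + 10) with hF
  have hF0 : 0 ≤ F := by rw [hF]; positivity
  -- choose `𝓛 ≥ L₀` with `C·(F + 1)/𝓛 ≤ δ`
  obtain ⟨D₀, hD₀⟩ := exists_nat_ell_ge (max 1 (C * (F + 1) / δ + 1))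
  refine ForAllLarge.of_le D₀ fun D _ _ hD _ _ => ?_
  obtain ⟨hℓ1, hℓδ⟩ := max_le_iff.mp (hD₀ D hD)
  set ℓ : ℝ := ell D with hℓ
  have hℓ0 : 0 < ℓ := by linarith
  have hE0 : 0 ≤ Real.exp (-c * ℓ ^ (1 / 10 : ℝ)) + (ℓ ^ 1995)⁻¹ := by positivity
  refine ⟨mul_nonneg hC hE0, ?_⟩
  -- the exponential piece
  have h1 : Real.exp (-c * ℓ ^ (1 / 10 : ℝ)) * ℓ ^ m ≤ F * ℓ⁻¹ := by
    rw [mul_comm]; exact pow_mul_exp_neg_rpow_tenth_le hℓ1 hc m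
  -- the power piece: `𝓛^m/𝓛^1995 ≤ 1/𝓛`
  have h2 : (ℓ ^ 1995)⁻¹ * ℓ ^ m ≤ ℓ⁻¹ := by
    have hsplit : ℓ ^ 1995 = ℓ ^ (1994 - m) * ℓ ^ m * ℓ := by
      rw [← pow_add, ← pow_succ]; congr 1; omega
    rw [hsplit]
    have hA : (1 : ℝ) ≤ ℓ ^ (1994 - m) := one_le_pow₀ hℓ1
    have hm0 : 0 < ℓ ^ m := pow_pos hℓ0 m
    rw [mul_inv, mul_inv, mul_assoc, mul_assoc]
    have : (ℓ ^ m)⁻¹ * (ℓ⁻¹ * ℓ ^ m) = ℓ⁻¹ := by field_simp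
    rw [this]
    calc (ℓ ^ (1994 - m))⁻¹ * ℓ⁻¹ ≤ 1 * ℓ⁻¹ :=
          mul_le_mul_of_nonneg_right (inv_le_one_of_one_le₀ hA) (inv_nonneg.mpr hℓ0.le)
      _ = ℓ⁻¹ := one_mul _
  have h3 : (Real.exp (-c * ℓ ^ (1 / 10 : ℝ)) + (ℓ ^ 1995)⁻¹) * ℓ ^ m ≤ (F + 1) * ℓ⁻¹ := by
    rw [add_mul, add_mul, one_mul]; exact add_le_add h1 h2
  have h4 : C * (F + 1) * ℓ⁻¹ ≤ δ := by
    rw [← div_eq_mul_inv, div_le_iff₀ hℓ0]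
    have : C * (F + 1) / δ * δ = C * (F + 1) := by field_simp
    nlinarith [hℓδ, hδ, this]
  calc C * (Real.exp (-c * ℓ ^ (1 / 10 : ℝ)) + (ℓ ^ 1995)⁻¹) * ℓ ^ m
      = C * ((Real.exp (-c * ℓ ^ (1 / 10 : ℝ)) + (ℓ ^ 1995)⁻¹) * ℓ ^ m) := by ring
    _ ≤ C * ((F + 1) * ℓ⁻¹) := mul_le_mul_of_nonneg_left h3 hC
    _ = C * (F + 1) * ℓ⁻¹ := by ring
    _ ≤ δ := h4

/-- **The same for a general power `𝓛^{−A}`** (the lane may settle on `A = 1994` or a free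
`A ≥ 100`): for `C ≥ 0`, `c > 0` and `m + 1 ≤ A`, `E(D) = C·(e^{−c𝓛^{1/10}} + (𝓛^{A})⁻¹)` satisfies
`∀ δ > 0, ForAllLarge (0 ≤ E D ∧ E D·𝓛^m ≤ δ)`. [cite: Zhang2022LandauSiegel, §15 (15.17) p.85] -/
theorem eq15_15_error_decay_pow {C c : ℝ} (hC : 0 ≤ C) (hc : 0 < c) {m A : ℕ} (hmA : m + 1 ≤ A) :
    ∀ δ : ℝ, 0 < δ → ForAllLarge fun D _ _ =>
      0 ≤ C * (Real.exp (-c * ell D ^ (1 / 10 : ℝ)) + (ell D ^ A)⁻¹) ∧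
        C * (Real.exp (-c * ell D ^ (1 / 10 : ℝ)) + (ell D ^ A)⁻¹) * ell D ^ m ≤ δ := by
  intro δ hδ
  set F : ℝ := (Nat.factorial (10 * m + 10) : ℝ) / c ^ (10 * m + 10) with hF
  have hF0 : 0 ≤ F := by rw [hF]; positivity
  obtain ⟨D₀, hD₀⟩ := exists_nat_ell_ge (max 1 (C * (F + 1) / δ + 1))
  refine ForAllLarge.of_le D₀ fun D _ _ hD _ _ => ?_
  obtain ⟨hℓ1, hℓδ⟩ := max_le_iff.mp (hD₀ D hD)
  set ℓ : ℝ := ell D with hℓ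
  have hℓ0 : 0 < ℓ := by linarith
  have hE0 : 0 ≤ Real.exp (-c * ℓ ^ (1 / 10 : ℝ)) + (ℓ ^ A)⁻¹ := by positivity
  refine ⟨mul_nonneg hC hE0, ?_⟩
  have h1 : Real.exp (-c * ℓ ^ (1 / 10 : ℝ)) * ℓ ^ m ≤ F * ℓ⁻¹ := by
    rw [mul_comm]; exact pow_mul_exp_neg_rpow_tenth_le hℓ1 hc m
  have h2 : (ℓ ^ A)⁻¹ * ℓ ^ m ≤ ℓ⁻¹ := by
    have hsplit : ℓ ^ A = ℓ ^ (A - m - 1) * ℓ ^ m * ℓ := by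
      rw [← pow_add, ← pow_succ]; congr 1; omega
    rw [hsplit]
    have hA : (1 : ℝ) ≤ ℓ ^ (A - m - 1) := one_le_pow₀ hℓ1
    have hm0 : 0 < ℓ ^ m := pow_pos hℓ0 m
    rw [mul_inv, mul_inv, mul_assoc, mul_assoc]
    have : (ℓ ^ m)⁻¹ * (ℓ⁻¹ * ℓ ^ m) = ℓ⁻¹ := by field_simp
    rw [this]
    calc (ℓ ^ (A - m - 1))⁻¹ * ℓ⁻¹ ≤ 1 * ℓ⁻¹ :=
          mul_le_mul_of_nonneg_right (inv_le_one_of_one_le₀ hA) (inv_nonneg.mpr hℓ0.le)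
      _ = ℓ⁻¹ := one_mul _
  have h3 : (Real.exp (-c * ℓ ^ (1 / 10 : ℝ)) + (ℓ ^ A)⁻¹) * ℓ ^ m ≤ (F + 1) * ℓ⁻¹ := by
    rw [add_mul, add_mul, one_mul]; exact add_le_add h1 h2
  have h4 : C * (F + 1) * ℓ⁻¹ ≤ δ := by
    rw [← div_eq_mul_inv, div_le_iff₀ hℓ0]
    have : C * (F + 1) / δ * δ = C * (F + 1) := by field_simp
    nlinarith [hℓδ, hδ, this]
  calc C * (Real.exp (-c * ℓ ^ (1 / 10 : ℝ)) + (ℓ ^ A)⁻¹) * ℓ ^ m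
      = C * ((Real.exp (-c * ℓ ^ (1 / 10 : ℝ)) + (ℓ ^ A)⁻¹) * ℓ ^ m) := by ring
    _ ≤ C * ((F + 1) * ℓ⁻¹) := mul_le_mul_of_nonneg_left h3 hC
    _ = C * (F + 1) * ℓ⁻¹ := by ring
    _ ≤ δ := h4

/-- **Pure exponential error** (the printed `O(ε₁)`): for `C ≥ 0`, `c > 0` and any `m`,
`E(D) = C·e^{−c𝓛^{1/10}}` satisfies `∀ δ > 0, ForAllLarge (0 ≤ E D ∧ E D·𝓛^m ≤ δ)`.
[cite: Zhang2022LandauSiegel, §15 (15.15) p.85] -/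
theorem exp_error_decay {C c : ℝ} (hC : 0 ≤ C) (hc : 0 < c) (m : ℕ) :
    ∀ δ : ℝ, 0 < δ → ForAllLarge fun D _ _ =>
      0 ≤ C * Real.exp (-c * ell D ^ (1 / 10 : ℝ)) ∧
        C * Real.exp (-c * ell D ^ (1 / 10 : ℝ)) * ell D ^ m ≤ δ := by
  intro δ hδ
  obtain ⟨D₁, hD₁⟩ := exists_nat_ell_ge 1
  have hLarge : ForAllLarge fun D _ _ => D₁ ≤ D := ForAllLarge.of_le D₁ fun D _ _ hD _ _ => hD
  refine ((eq15_15_error_decay_pow hC hc (m := m) (A := m + 1) le_rfl δ hδ).and hLarge).mono ?_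
  intro D _ _ _ _ ⟨⟨_, h⟩, hD⟩
  have hℓ0 : 0 ≤ ell D := zero_le_one.trans (hD₁ D hD)
  refine ⟨mul_nonneg hC (Real.exp_pos _).le, le_trans ?_ h⟩
  have hinv : 0 ≤ (ell D ^ (m + 1))⁻¹ := inv_nonneg.mpr (pow_nonneg hℓ0 _)
  have hm : 0 ≤ ell D ^ m := pow_nonneg hℓ0 m
  have : C * Real.exp (-c * ell D ^ (1 / 10 : ℝ)) ≤
      C * (Real.exp (-c * ell D ^ (1 / 10 : ℝ)) + (ell D ^ (m + 1))⁻¹) :=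
    mul_le_mul_of_nonneg_left (by linarith) hC
  exact mul_le_mul_of_nonneg_right this hm

end Literature.NumberTheory.LFunctions.Zhang2022.Typed.Section15B

end
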